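import Summits.QuantumFields.YangMills.Theorems.UnitScaleTiltProp7GreenPiBlockLettersEdition
import HarnessLib

/-!
# Route `UnitScaleTilt`, crux K1 «MinimiserStabilityRegPr» (stmt-QuantumFields-19200), EX rows `h133`∕`h137kπ` — NORM_G ROAD brick N6, FILE D4: **THE PERTURBATION `G_π − G₀` HAS
# α-SMALL, DECAYING ROWS** (the N6 input of the CONE ROUTE to `hKinv(Π)`: `K_π − K₀ = Q_k(G_π − G₀)Q_k†`, CHAIR WORD №34)

Cell `ym3-torus` (HUMAN RULING D-0037; rung R3 = SU(2) YM₃ on T³ — NOT d = 4, NOT infinite volume, NOT a mass gap, NOT Clay).  Fleet lead ∕ chair seat `ym-ust-19200-p1` (gen 27).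
THEOREMS ONLY (0 `def`, 0 `sorry`); `--supports stmt-QuantumFields-19200 --as helper`; count-neutral.

THE MATHEMATICS.  By FILE C's identity ✓`GT_pi_eq_four_terms`, `G_πf − G₀f = G₀(Δ^η(Dλ₁)) + Dλ₂ − G₀(Δ^η(Dλ₂))`, `λ₁ = G′ᴾR_SD*(G_πf)`, `λ₂ = G′ᴾR_SG′ᴾ(D*Δ^η(Pᴾ G_πf))`: every term
carries ONE local multiplier `Δ^ηD` or `D*Δ^η`, which is `O(α)` on `RegPr α` (✓D1 `DeltaEta_DL2_decay`, `DstarL2_DeltaEta_decay`).  Feeding FILE D2's conclusion (`G_π`-values and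
divergences of a block-supported source decay like `2(BV+BD)·s·e^{−δ·dc}`) back into the three correction terms gives rows of `G_π − G₀` with the α-SMALL constants
`κ_V := 2(BV+BD)·(1+e^{4δ})·[2αC₁BV + 6αC₃(1+C₂)(C₂ + 2α(1+e^{4δ})C₁BV)]`, `κ_D := 2(BV+BD)·(1+e^{4δ})·[2αC₁BD + 6αC₃(1+C₂)(1 + 2α(1+e^{4δ})C₁BD)]` — no second fixpoint.

WHAT IS PROVED (ns `…Theorems.Prop7GreenPiMinusEtaBlockDecay`; member `F n K`, `h : n ≤ K`, weights `c₀ cB > 0`, coupling `0 ≤ a`, rate `0 ≤ δ`).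
* `pointwise_of_three_terms` — abstract `map_add`∕`norm_add_le` bookkeeping for `u − G₀f = G₀A₁ + (Dℓ₂ − G₀A₂)`.
* ★★★ `blockDecay_rows_GTpi_sub_GTeta_of_letters` — on `RegPr α`, `PosOnto` at `Δ^η` and `Δ_πᴾ`, D2's weighted letters `hGw hDw hc1w hc2w hc3w` about the block `z` and D2's window:
  for `X` supported on the bonds of block `z` with `‖X b‖ ≤ s`, `‖toL2⁻¹(G_π(toL2 X) − G₀(toL2 X)) bd‖ ≤ κ_V·s·e^{−δ·dc(B bd₋, z)}` and
  `‖toL2S⁻¹(D*(G_π(toL2 X) − G₀(toL2 X))) x‖ ≤ κ_D·s·e^{−δ·dc(B x, z)}`.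
* ★★★ `hDelta_pi_of_letters` ∕ ★★★ `hDelta_pi_of_blockLetters` — the VALUE row as px10 g14's cone letter `hΔb` (LinearMap difference `GT_π − GT₀`, binders `X z hXz s hs hX bd`,
  `κΔ = α·κ′` with the α-factor explicit), from D2's weighted letters resp. from D3's five BLOCK letters (constants `×(2(1+1∕ν))³`).
CONSUMER.  The K-storey's cone step «`hKinv(Π)` ⟸ `hKinv(η)` + the coarse kernel row of `Q_k(G_π − G₀)Q_k†`» (px10 lineage, (K1-alg) around `K₀`; coarse volume `O(1)`), dressing these
fine rows with the `Q_k`∕`Q_k†` block rows.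
HONEST SCOPE.  Bookkeeping over displayed letters (suppliers: (Gw)∕(Dw) ⟸ px16 ✓p768545 §3 ∕ px21 ✓p770568 via ✓D3 `weighted_of_blockSupported`; (c·w) ⟸ px5 g14 W4); nothing of
`hKinv`, `h133`, `h137kπ`, the 8 EX rows, `hThm2S`, EX or the crux is proved; nothing continuum ∕ Clay.

References: T. Bałaban, CMP **99** (1985) 389–434 [Balaban1985BackgroundPropagators] ((3.122) p.420, (3.130)–(3.131) pp.421–422, (3.136)–(3.137) p.423, Thm 3.12 p.423).
-/

set_option autoImplicit false

noncomputable section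

open scoped Matrix.Norms.L2Operator BigOperators InnerProductSpace ComplexConjugate
open Complex (I)

namespace Summit.QuantumFields.YangMills.Theorems.Prop7GreenPiMinusEtaBlockDecay

open Literature.MathematicalPhysics.QuantumFieldTheory.Balaban1983to89
open Literature.MathematicalPhysics.QuantumFieldTheory.Balaban1983to89.T3ContinuumYM3Torus
open T3PrintedRegularMinimiser (RegPr)
open T3SectALandauChart (formComp bgUnits eta eta_pos)
open B5Eq118OneStroke (iterBlockOf)
open B9TorusCalculus (torusT)
open B9Eq39Adjoint (R bondPair J)
open B9Eq310Hermitian (norm_R_le)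
open B9Eq3131Pointwise (norm_I_ad_le)
open Beta.BackgroundVertices (ad ad_apply)
open B9Eq311L2Pairing (WL2)
open B11Eq103H1Complex (SiteL2K BondL2K)
open Summit.QuantumFields.YangMills.Theorems.Prop7SectET3Transport (periodsT3)
open Summit.QuantumFields.YangMills.Theorems.Prop7SectET3HilbertLetters (W₂ toL2 toL2S QL2 DL2 DstarL2 covLapSite adjoint_DL2)
open Summit.QuantumFields.YangMills.Theorems.Prop7SectET3GaugeProjector (NS RS RS_RS)
open Summit.QuantumFields.YangMills.Theorems.Prop7SectET3WilsonHessian (DeltaEta DeltaEtaSlot DeltaEta_isSymmetric)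
open Summit.QuantumFields.YangMills.Theorems.Prop7SectET3CurvedPropagators (Qk laplaceA PosOnto GT)
open Summit.QuantumFields.YangMills.Theorems.Prop7SectET3DeltaPiPInv (GprimeP gaugeCorrP DeltaPiSlotP gaugeCorrP_apply)
open Summit.QuantumFields.YangMills.Theorems.Prop7SecondOrderDict (norm_bgUnits_le_one)
open Summit.QuantumFields.YangMills.Theorems.Prop7DeltaPiDefectPairing (inner_DL2_toL2S_DeltaEta_toL2 norm_J_one_le_of_regPr)
open Summit.QuantumFields.YangMills.Theorems.Prop7CurrentPairingPointwise (norm_apply_le_of_norm_inner_siteSingle_le norm_symm_DeltaEta_DL2_toL2S_apply_le)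
open Summit.QuantumFields.YangMills.Theorems.Prop7GreenPiSupRowsOfLetters (GT_pi_eq_four_terms covLapSite_lambda₂ bootstrap_two pointwise_of_four_terms)
open Summit.QuantumFields.YangMills.Theorems.Prop7BlockDistanceWeights (tdist_iterBlockOf_le tdist_src_tgt_le_one tdist_coarse_triangle tdist_coarse_comm sum_exp_neg_mul_tdist_coarse_le)

open Summit.QuantumFields.YangMills.Theorems.Prop7GreenPiBlockDecayLocal (DeltaEta_DL2_decay DstarL2_DeltaEta_decay)
open Summit.QuantumFields.YangMills.Theorems.Prop7GreenPiBlockDecayOfLetters (blockDecay_rows_GTpi_of_letters)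
open Summit.QuantumFields.YangMills.Theorems.Prop7GreenPiBlockLettersEdition (weighted_of_blockSupported)
variable {F : T3Family} {n K : ℕ} {h : n ≤ K} {c₀ cB a : ℝ}

section Abstract

variable [Fact (0 < c₀)]

/-- **POINTWISE ASSEMBLY OF THE THREE CORRECTION TERMS**: if `u = G₀f + G₀A₁ + (Dℓ₂ − G₀A₂)` then `u − G₀f` and `D*(u − G₀f)` are bounded at a point by the sum of the bounds of the
three pieces there (abstract vectors, cheap elaboration). [folklore] -/
theorem pointwise_of_three_terms (G₀ : BondL2K ℂ 3 (periodsT3 F K) c₀ W₂ →ₗ[ℂ] BondL2K ℂ 3 (periodsT3 F K) c₀ W₂) (U₀ : GaugeField (F.P K) 0 (Matrix.specialUnitaryGroup (Fin 2) ℂ))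
    (u f A₁ A₂ Dl₂ : BondL2K ℂ 3 (periodsT3 F K) c₀ W₂) (h4 : u = G₀ f + G₀ A₁ + (Dl₂ - G₀ A₂)) (b₀ : PBond (F.P K) 0) (x₀ : Site (F.P K) 0)
    {a₁ a₂ a₃ d₁ d₂ d₃ : ℝ}
    (hV₁ : ‖(toL2 F K c₀).symm (G₀ A₁) b₀‖ ≤ a₁) (hDl₂ : ‖(toL2 F K c₀).symm Dl₂ b₀‖ ≤ a₂) (hV₂ : ‖(toL2 F K c₀).symm (G₀ A₂) b₀‖ ≤ a₃)
    (hD₁ : ‖(toL2S F K c₀).symm (DstarL2 F n K c₀ U₀ (G₀ A₁)) x₀‖ ≤ d₁) (hDDl₂ : ‖(toL2S F K c₀).symm (DstarL2 F n K c₀ U₀ Dl₂) x₀‖ ≤ d₂)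
    (hD₂ : ‖(toL2S F K c₀).symm (DstarL2 F n K c₀ U₀ (G₀ A₂)) x₀‖ ≤ d₃) :
    ‖(toL2 F K c₀).symm (u - G₀ f) b₀‖ ≤ a₁ + (a₂ + a₃) ∧ ‖(toL2S F K c₀).symm (DstarL2 F n K c₀ U₀ (u - G₀ f)) x₀‖ ≤ d₁ + (d₂ + d₃) := by
  have e : u - G₀ f = G₀ A₁ + (Dl₂ - G₀ A₂) := by rw [h4]; abel
  rw [e]
  constructor
  · simp only [map_add, map_sub, Pi.add_apply, Pi.sub_apply]
    exact (norm_add_le _ _).trans (add_le_add hV₁ ((norm_sub_le _ _).trans (add_le_add hDl₂ hV₂)))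
  · simp only [map_add, map_sub, Pi.add_apply, Pi.sub_apply]
    exact (norm_add_le _ _).trans (add_le_add hD₁ ((norm_sub_le _ _).trans (add_le_add hDDl₂ hD₂)))

end Abstract

/-! ## The rows of `G_π − G₀` -/

section Rows

variable [Fact (0 < c₀)] [Fact (0 < cB)]

/-- ★★★ **`G_π − G₀` HAS α-SMALL DECAYING ROWS** (the N6 input of the cone route to `hKinv(Π)`).  Same data as ✓D2 `blockDecay_rows_GTpi_of_letters` (member `U₀ ∈ RegPr α`, `PosOnto`
at `Δ^η` and `Δ_πᴾ`, `0 ≤ a`, `0 ≤ δ`, block `z`, weighted letters `hGw hDw hc1w hc2w hc3w`, window): for every `X` supported on the bonds of block `z` with `‖X b‖ ≤ s`,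
`‖toL2⁻¹(G_π(toL2 X) − G₀(toL2 X)) bd‖ ≤ κ_V·s·e^{−δ·dc(B bd₋,z)}` and `‖toL2S⁻¹(D*(G_π(toL2 X) − G₀(toL2 X))) x‖ ≤ κ_D·s·e^{−δ·dc(B x,z)}` with
`κ_V = 2(BV+BD)(1+e^{4δ})(2αC₁BV + 6αC₃(1+C₂)(C₂ + 2α(1+e^{4δ})C₁BV))`, `κ_D = 2(BV+BD)(1+e^{4δ})(2αC₁BD + 6αC₃(1+C₂)(1 + 2α(1+e^{4δ})C₁BD))` — both `O(α)`.
[cite: Balaban1985BackgroundPropagators, (3.122) p.420, (3.130)–(3.131) pp.421–422, (3.136)–(3.137) p.423] -/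
theorem blockDecay_rows_GTpi_sub_GTeta_of_letters {α δ : ℝ} (hδ : 0 ≤ δ) (U₀ : GaugeField (F.P K) 0 (Matrix.specialUnitaryGroup (Fin 2) ℂ)) (hreg : RegPr F n K α U₀) (ha : 0 ≤ a)
    (hp₀ : PosOnto F n K h c₀ cB a (DeltaEtaSlot F n K c₀) U₀) (hpπ : PosOnto F n K h c₀ cB a (DeltaPiSlotP F n K h c₀ cB a) U₀)
    (z : Site (F.P K) (K - n)) {BV BD C₁ C₂ C₃ : ℝ} (hBV : 0 ≤ BV) (hBD : 0 ≤ BD) (hC₁ : 0 ≤ C₁) (hC₂ : 0 ≤ C₂) (hC₃ : 0 ≤ C₃)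
    (hGw : ∀ (Y : PBond (F.P K) 0 → Matrix (Fin 2) (Fin 2) ℂ) (m : ℝ), 0 ≤ m →
      (∀ b, ‖Y b‖ ≤ m * Real.exp (-(δ * (Site.tdist (iterBlockOf (K - n) b.src) z : ℝ)))) →
      ∀ bd, ‖(toL2 F K c₀).symm (GT F n K h c₀ cB a (DeltaEtaSlot F n K c₀) U₀ (toL2 F K c₀ Y)) bd‖
        ≤ BV * m * Real.exp (-(δ * (Site.tdist (iterBlockOf (K - n) bd.src) z : ℝ))))
    (hDw : ∀ (Y : PBond (F.P K) 0 → Matrix (Fin 2) (Fin 2) ℂ) (m : ℝ), 0 ≤ m →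
      (∀ b, ‖Y b‖ ≤ m * Real.exp (-(δ * (Site.tdist (iterBlockOf (K - n) b.src) z : ℝ)))) →
      ∀ x, ‖(toL2S F K c₀).symm (DstarL2 F n K c₀ U₀ (GT F n K h c₀ cB a (DeltaEtaSlot F n K c₀) U₀ (toL2 F K c₀ Y))) x‖
        ≤ BD * m * Real.exp (-(δ * (Site.tdist (iterBlockOf (K - n) x) z : ℝ))))
    (hc1w : ∀ (v : Site (F.P K) 0 → Matrix (Fin 2) (Fin 2) ℂ) (m : ℝ), 0 ≤ m →
      (∀ y, ‖v y‖ ≤ m * Real.exp (-(δ * (Site.tdist (iterBlockOf (K - n) y) z : ℝ)))) →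
      ∀ y, ‖(toL2S F K c₀).symm (GprimeP F n K h c₀ cB a U₀ (RS F n K h c₀ cB U₀ (toL2S F K c₀ v))) y‖
        ≤ C₁ * m * Real.exp (-(δ * (Site.tdist (iterBlockOf (K - n) y) z : ℝ))))
    (hc2w : ∀ (v : Site (F.P K) 0 → Matrix (Fin 2) (Fin 2) ℂ) (m : ℝ), 0 ≤ m →
      (∀ y, ‖v y‖ ≤ m * Real.exp (-(δ * (Site.tdist (iterBlockOf (K - n) y) z : ℝ)))) →
      ∀ b, ‖(toL2 F K c₀).symm (DL2 F n K c₀ U₀ (GprimeP F n K h c₀ cB a U₀ (RS F n K h c₀ cB U₀ (toL2S F K c₀ v)))) b‖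
        ≤ C₂ * m * Real.exp (-(δ * (Site.tdist (iterBlockOf (K - n) b.src) z : ℝ))))
    (hc3w : ∀ (v : Site (F.P K) 0 → Matrix (Fin 2) (Fin 2) ℂ) (m : ℝ), 0 ≤ m →
      (∀ y, ‖v y‖ ≤ m * Real.exp (-(δ * (Site.tdist (iterBlockOf (K - n) y) z : ℝ)))) →
      ∀ y, ‖(toL2S F K c₀).symm (RS F n K h c₀ cB U₀ (GprimeP F n K h c₀ cB a U₀ (toL2S F K c₀ v))) y‖
        ≤ C₃ * m * Real.exp (-(δ * (Site.tdist (iterBlockOf (K - n) y) z : ℝ))))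
    (hwin : 2 * (1 + Real.exp (4 * δ)) * (α * C₁ * (BV + BD)
      + 3 * α * C₃ * (1 + C₂) * (1 + C₂ + 2 * (1 + Real.exp (4 * δ)) * α * C₁ * (BV + BD))) ≤ 1 / 2)
    (X : PBond (F.P K) 0 → Matrix (Fin 2) (Fin 2) ℂ) (hXz : ∀ b, X b ≠ 0 → iterBlockOf (K - n) b.src = z) {s : ℝ} (hs : 0 ≤ s) (hX : ∀ b, ‖X b‖ ≤ s) :
    (∀ bd, ‖(toL2 F K c₀).symm (GT F n K h c₀ cB a (DeltaPiSlotP F n K h c₀ cB a) U₀ (toL2 F K c₀ X) - GT F n K h c₀ cB a (DeltaEtaSlot F n K c₀) U₀ (toL2 F K c₀ X)) bd‖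
        ≤ 2 * (BV + BD) * (1 + Real.exp (4 * δ)) * (2 * α * C₁ * BV + 6 * α * C₃ * (1 + C₂) * (C₂ + 2 * α * (1 + Real.exp (4 * δ)) * C₁ * BV)) * s * Real.exp (-(δ * (Site.tdist (iterBlockOf (K - n) bd.src) z : ℝ)))) ∧
    (∀ x, ‖(toL2S F K c₀).symm (DstarL2 F n K c₀ U₀ (GT F n K h c₀ cB a (DeltaPiSlotP F n K h c₀ cB a) U₀ (toL2 F K c₀ X) - GT F n K h c₀ cB a (DeltaEtaSlot F n K c₀) U₀ (toL2 F K c₀ X))) x‖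
        ≤ 2 * (BV + BD) * (1 + Real.exp (4 * δ)) * (2 * α * C₁ * BD + 6 * α * C₃ * (1 + C₂) * (1 + 2 * α * (1 + Real.exp (4 * δ)) * C₁ * BD)) * s * Real.exp (-(δ * (Site.tdist (iterBlockOf (K - n) x) z : ℝ)))) := by
  classical
  have hη : 0 < eta F n K := eta_pos F n K
  have hα : 0 ≤ α := by
    have hJ := norm_J_one_le_of_regPr U₀ hreg 0 (Classical.arbitrary _)
    have h0 : 0 * eta F n K ^ 3 ≤ α * eta F n K ^ 3 := by rw [zero_mul]; exact (norm_nonneg _).trans hJ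
    exact le_of_mul_le_mul_right h0 (pow_pos hη 3)
  have hE4 : 0 ≤ 1 + Real.exp (4 * δ) := by positivity
  -- D2: the rows of `u = G_πf` and `D*u` themselves
  have hD2 := blockDecay_rows_GTpi_of_letters hδ U₀ hreg ha hp₀ hpπ z hBV hBD hC₁ hC₂ hC₃ hGw hDw hc1w hc2w hc3w hwin X hXz hs hX
  have hN0 : 0 ≤ 2 * (BV + BD) * s := by positivity
  -- the identity and the objects
  have h4 := GT_pi_eq_four_terms (h := h) (cB := cB) ha hp₀ hpπ (toL2 F K c₀ X)
  set f := toL2 F K c₀ X with hf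
  set u := GT F n K h c₀ cB a (DeltaPiSlotP F n K h c₀ cB a) U₀ f with hu
  set lam₁ := GprimeP F n K h c₀ cB a U₀ (RS F n K h c₀ cB U₀ (DstarL2 F n K c₀ U₀ u)) with hlam₁
  set j := DstarL2 F n K c₀ U₀ (DeltaEta F n K c₀ U₀ (gaugeCorrP F n K h c₀ cB a U₀ u)) with hj
  set lam₂ := GprimeP F n K h c₀ cB a U₀ (RS F n K h c₀ cB U₀ (GprimeP F n K h c₀ cB a U₀ j)) with hlam₂
  set G₀ := GT F n K h c₀ cB a (DeltaEtaSlot F n K c₀) U₀ with hG₀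
  set V : Site (F.P K) 0 → Matrix (Fin 2) (Fin 2) ℂ := (toL2S F K c₀).symm (DstarL2 F n K c₀ U₀ u) with hVd
  have hUb : ∀ b, ‖(toL2 F K c₀).symm u b‖ ≤ 2 * (BV + BD) * s * Real.exp (-(δ * (Site.tdist (iterBlockOf (K - n) b.src) z : ℝ))) := hD2.1
  have hVx : ∀ y, ‖V y‖ ≤ 2 * (BV + BD) * s * Real.exp (-(δ * (Site.tdist (iterBlockOf (K - n) y) z : ℝ))) := hD2.2
  -- (c1w)(c2w) on `λ₁`
  have hVeq : toL2S F K c₀ V = DstarL2 F n K c₀ U₀ u := LinearEquiv.apply_symm_apply _ _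
  have hlam₁V : lam₁ = GprimeP F n K h c₀ cB a U₀ (RS F n K h c₀ cB U₀ (toL2S F K c₀ V)) := by rw [hVeq]
  have hl₁ : ∀ y, ‖(toL2S F K c₀).symm lam₁ y‖ ≤ C₁ * (2 * (BV + BD) * s) * Real.exp (-(δ * (Site.tdist (iterBlockOf (K - n) y) z : ℝ))) := fun y => by
    rw [hlam₁V]; exact hc1w V _ hN0 hVx y
  have hDl₁ : ∀ b, ‖(toL2 F K c₀).symm (DL2 F n K c₀ U₀ lam₁) b‖ ≤ C₂ * (2 * (BV + BD) * s) * Real.exp (-(δ * (Site.tdist (iterBlockOf (K - n) b.src) z : ℝ))) := fun b => by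
    rw [hlam₁V]; exact hc2w V _ hN0 hVx b
  -- `Pᴾu = u − Dλ₁`
  set Pu : PBond (F.P K) 0 → Matrix (Fin 2) (Fin 2) ℂ := (toL2 F K c₀).symm (gaugeCorrP F n K h c₀ cB a U₀ u) with hPu
  have hPu_le : ∀ b, ‖Pu b‖ ≤ ((1 + C₂) * (2 * (BV + BD) * s)) * Real.exp (-(δ * (Site.tdist (iterBlockOf (K - n) b.src) z : ℝ))) := by
    intro b
    have e : Pu b = (toL2 F K c₀).symm u b - (toL2 F K c₀).symm (DL2 F n K c₀ U₀ lam₁) b := by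
      rw [hPu, gaugeCorrP_apply, map_sub, Pi.sub_apply]
    rw [e]
    calc _ ≤ 2 * (BV + BD) * s * Real.exp (-(δ * (Site.tdist (iterBlockOf (K - n) b.src) z : ℝ))) + C₂ * (2 * (BV + BD) * s) * Real.exp (-(δ * (Site.tdist (iterBlockOf (K - n) b.src) z : ℝ))) := (norm_sub_le _ _).trans (add_le_add (hUb b) (hDl₁ b))
      _ = _ := by ring
  have hPueq : toL2 F K c₀ Pu = gaugeCorrP F n K h c₀ cB a U₀ u := LinearEquiv.apply_symm_apply _ _
  have hP0 : 0 ≤ (1 + C₂) * (2 * (BV + BD) * s) := by positivity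
  have hjle : ∀ y, ‖(toL2S F K c₀).symm j y‖ ≤ 6 * α * (1 + Real.exp (4 * δ)) * ((1 + C₂) * (2 * (BV + BD) * s)) * Real.exp (-(δ * (Site.tdist (iterBlockOf (K - n) y) z : ℝ))) := by
    intro y
    rw [hj, ← hPueq]
    exact DstarL2_DeltaEta_decay hδ U₀ hreg Pu z hP0 hPu_le y
  have hJ0 : 0 ≤ 6 * α * (1 + Real.exp (4 * δ)) * ((1 + C₂) * (2 * (BV + BD) * s)) := by positivity
  -- (c3w) on `g₂ = R_S(G′ᴾ j)`, then (c1w)(c2w) on `λ₂`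
  set Jv : Site (F.P K) 0 → Matrix (Fin 2) (Fin 2) ℂ := (toL2S F K c₀).symm j with hJv
  have hJveq : toL2S F K c₀ Jv = j := LinearEquiv.apply_symm_apply _ _
  set g₂ := RS F n K h c₀ cB U₀ (GprimeP F n K h c₀ cB a U₀ j) with hg₂
  have hg₂le : ∀ y, ‖(toL2S F K c₀).symm g₂ y‖ ≤ C₃ * (6 * α * (1 + Real.exp (4 * δ)) * ((1 + C₂) * (2 * (BV + BD) * s))) * Real.exp (-(δ * (Site.tdist (iterBlockOf (K - n) y) z : ℝ))) :=
    fun y => by rw [hg₂, ← hJveq]; exact hc3w Jv _ hJ0 hjle y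
  have hG20 : 0 ≤ C₃ * (6 * α * (1 + Real.exp (4 * δ)) * ((1 + C₂) * (2 * (BV + BD) * s))) := by positivity
  set Gv : Site (F.P K) 0 → Matrix (Fin 2) (Fin 2) ℂ := (toL2S F K c₀).symm g₂ with hGv
  have hGveq : toL2S F K c₀ Gv = g₂ := LinearEquiv.apply_symm_apply _ _
  have hlam₂G : lam₂ = GprimeP F n K h c₀ cB a U₀ (RS F n K h c₀ cB U₀ (toL2S F K c₀ Gv)) := by rw [hGveq, hg₂, RS_RS]
  have hl₂ : ∀ y, ‖(toL2S F K c₀).symm lam₂ y‖ ≤ C₁ * (C₃ * (6 * α * (1 + Real.exp (4 * δ)) * ((1 + C₂) * (2 * (BV + BD) * s)))) * Real.exp (-(δ * (Site.tdist (iterBlockOf (K - n) y) z : ℝ))) :=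
    fun y => by rw [hlam₂G]; exact hc1w Gv _ hG20 hg₂le y
  have hDl₂ : ∀ b, ‖(toL2 F K c₀).symm (DL2 F n K c₀ U₀ lam₂) b‖ ≤ C₂ * (C₃ * (6 * α * (1 + Real.exp (4 * δ)) * ((1 + C₂) * (2 * (BV + BD) * s)))) * Real.exp (-(δ * (Site.tdist (iterBlockOf (K - n) b.src) z : ℝ))) :=
    fun b => by rw [hlam₂G]; exact hc2w Gv _ hG20 hg₂le b
  -- (C-val) decayed on the two defect sources
  have hsrc : ∀ (lam : SiteL2K ℂ 3 (periodsT3 F K) c₀ W₂) (m : ℝ), 0 ≤ m →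
      (∀ y, ‖(toL2S F K c₀).symm lam y‖ ≤ m * Real.exp (-(δ * (Site.tdist (iterBlockOf (K - n) y) z : ℝ)))) →
      ∀ b, ‖(toL2 F K c₀).symm (DeltaEta F n K c₀ U₀ (DL2 F n K c₀ U₀ lam)) b‖ ≤ 2 * α * (1 + Real.exp (4 * δ)) * m * Real.exp (-(δ * (Site.tdist (iterBlockOf (K - n) b.src) z : ℝ))) := by
    intro lam m hm0 hm b
    have e : lam = toL2S F K c₀ ((toL2S F K c₀).symm lam) := (LinearEquiv.apply_symm_apply _ _).symm
    rw [e]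
    exact DeltaEta_DL2_decay hδ U₀ hreg _ z hm0 hm b
  have hS₁ := hsrc lam₁ (C₁ * (2 * (BV + BD) * s)) (by positivity) hl₁
  have hS₂ := hsrc lam₂ (C₁ * (C₃ * (6 * α * (1 + Real.exp (4 * δ)) * ((1 + C₂) * (2 * (BV + BD) * s))))) (by positivity) hl₂
  -- the `G₀` rows on the two decaying defect sources
  have hread : ∀ y : BondL2K ℂ 3 (periodsT3 F K) c₀ W₂, y = toL2 F K c₀ ((toL2 F K c₀).symm y) := fun y => (LinearEquiv.apply_symm_apply _ _).symm
  have hV₁ : ∀ b, ‖(toL2 F K c₀).symm (G₀ (DeltaEta F n K c₀ U₀ (DL2 F n K c₀ U₀ lam₁))) b‖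
      ≤ BV * (2 * α * (1 + Real.exp (4 * δ)) * (C₁ * (2 * (BV + BD) * s))) * Real.exp (-(δ * (Site.tdist (iterBlockOf (K - n) b.src) z : ℝ))) := fun b => by
    rw [hread (DeltaEta F n K c₀ U₀ (DL2 F n K c₀ U₀ lam₁))]; exact hGw _ _ (by positivity) hS₁ b
  have hV₂ : ∀ b, ‖(toL2 F K c₀).symm (G₀ (DeltaEta F n K c₀ U₀ (DL2 F n K c₀ U₀ lam₂))) b‖
      ≤ BV * (2 * α * (1 + Real.exp (4 * δ)) * (C₁ * (C₃ * (6 * α * (1 + Real.exp (4 * δ)) * ((1 + C₂) * (2 * (BV + BD) * s)))))) * Real.exp (-(δ * (Site.tdist (iterBlockOf (K - n) b.src) z : ℝ))) :=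
    fun b => by rw [hread (DeltaEta F n K c₀ U₀ (DL2 F n K c₀ U₀ lam₂))]; exact hGw _ _ (by positivity) hS₂ b
  have hD₁ : ∀ y, ‖(toL2S F K c₀).symm (DstarL2 F n K c₀ U₀ (G₀ (DeltaEta F n K c₀ U₀ (DL2 F n K c₀ U₀ lam₁)))) y‖
      ≤ BD * (2 * α * (1 + Real.exp (4 * δ)) * (C₁ * (2 * (BV + BD) * s))) * Real.exp (-(δ * (Site.tdist (iterBlockOf (K - n) y) z : ℝ))) := fun y => by
    rw [hread (DeltaEta F n K c₀ U₀ (DL2 F n K c₀ U₀ lam₁))]; exact hDw _ _ (by positivity) hS₁ y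
  have hD₂ : ∀ y, ‖(toL2S F K c₀).symm (DstarL2 F n K c₀ U₀ (G₀ (DeltaEta F n K c₀ U₀ (DL2 F n K c₀ U₀ lam₂)))) y‖
      ≤ BD * (2 * α * (1 + Real.exp (4 * δ)) * (C₁ * (C₃ * (6 * α * (1 + Real.exp (4 * δ)) * ((1 + C₂) * (2 * (BV + BD) * s)))))) * Real.exp (-(δ * (Site.tdist (iterBlockOf (K - n) y) z : ℝ))) :=
    fun y => by rw [hread (DeltaEta F n K c₀ U₀ (DL2 F n K c₀ U₀ lam₂))]; exact hDw _ _ (by positivity) hS₂ y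
  have hDDl₂ : ∀ y, ‖(toL2S F K c₀).symm (DstarL2 F n K c₀ U₀ (DL2 F n K c₀ U₀ lam₂)) y‖
      ≤ C₃ * (6 * α * (1 + Real.exp (4 * δ)) * ((1 + C₂) * (2 * (BV + BD) * s))) * Real.exp (-(δ * (Site.tdist (iterBlockOf (K - n) y) z : ℝ))) := fun y => by
    rw [hlam₂, covLapSite_lambda₂ (h := h) (cB := cB) ha U₀ j]; exact hg₂le y
  -- assembly at every point
  refine ⟨fun bd => ?_, fun x => ?_⟩
  · have hasm := (pointwise_of_three_terms (n := n) G₀ U₀ u f _ _ _ h4 bd bd.src (hV₁ bd) (hDl₂ bd) (hV₂ bd) (hD₁ bd.src) (hDDl₂ bd.src) (hD₂ bd.src)).1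
    exact hasm.trans (le_of_eq (by ring))
  · have hasm := (pointwise_of_three_terms (n := n) G₀ U₀ u f _ _ _ h4 ⟨x, 0⟩ x (hV₁ _) (hDl₂ _) (hV₂ _) (hD₁ x) (hDDl₂ x) (hD₂ x)).2
    exact hasm.trans (le_of_eq (by ring))


/-- ★★★ **THE CONE'S LETTER `hΔb` (px10 g14's currency)**: the VALUE row of the LinearMap difference `GT_π − GT₀` on block-supported sources, in the block-letter binder shape
`X z hXz s hs hX bd`, with the α-FACTOR EXPLICIT — `κΔ = α·κ′`, `κ′ = 2(BV+BD)(1+e^{4δ})(2C₁BV + 6C₃(1+C₂)(C₂ + 2α(1+e^{4δ})C₁BV))` — from D2's weighted letters quantified over the block.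
[cite: Balaban1985BackgroundPropagators, (3.122) p.420, (3.136)–(3.137) p.423] -/
theorem hDelta_pi_of_letters {α δ : ℝ} (hδ : 0 ≤ δ) (U₀ : GaugeField (F.P K) 0 (Matrix.specialUnitaryGroup (Fin 2) ℂ)) (hreg : RegPr F n K α U₀) (ha : 0 ≤ a)
    (hp₀ : PosOnto F n K h c₀ cB a (DeltaEtaSlot F n K c₀) U₀) (hpπ : PosOnto F n K h c₀ cB a (DeltaPiSlotP F n K h c₀ cB a) U₀)
    {BV BD C₁ C₂ C₃ : ℝ} (hBV : 0 ≤ BV) (hBD : 0 ≤ BD) (hC₁ : 0 ≤ C₁) (hC₂ : 0 ≤ C₂) (hC₃ : 0 ≤ C₃)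
    (hGw : ∀ (z : Site (F.P K) (K - n)) (Y : PBond (F.P K) 0 → Matrix (Fin 2) (Fin 2) ℂ) (m : ℝ), 0 ≤ m →
      (∀ b, ‖Y b‖ ≤ m * Real.exp (-(δ * (Site.tdist (iterBlockOf (K - n) b.src) z : ℝ)))) →
      ∀ bd, ‖(toL2 F K c₀).symm (GT F n K h c₀ cB a (DeltaEtaSlot F n K c₀) U₀ (toL2 F K c₀ Y)) bd‖
        ≤ BV * m * Real.exp (-(δ * (Site.tdist (iterBlockOf (K - n) bd.src) z : ℝ))))
    (hDw : ∀ (z : Site (F.P K) (K - n)) (Y : PBond (F.P K) 0 → Matrix (Fin 2) (Fin 2) ℂ) (m : ℝ), 0 ≤ m →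
      (∀ b, ‖Y b‖ ≤ m * Real.exp (-(δ * (Site.tdist (iterBlockOf (K - n) b.src) z : ℝ)))) →
      ∀ x, ‖(toL2S F K c₀).symm (DstarL2 F n K c₀ U₀ (GT F n K h c₀ cB a (DeltaEtaSlot F n K c₀) U₀ (toL2 F K c₀ Y))) x‖
        ≤ BD * m * Real.exp (-(δ * (Site.tdist (iterBlockOf (K - n) x) z : ℝ))))
    (hc1w : ∀ (z : Site (F.P K) (K - n)) (v : Site (F.P K) 0 → Matrix (Fin 2) (Fin 2) ℂ) (m : ℝ), 0 ≤ m →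
      (∀ y, ‖v y‖ ≤ m * Real.exp (-(δ * (Site.tdist (iterBlockOf (K - n) y) z : ℝ)))) →
      ∀ y, ‖(toL2S F K c₀).symm (GprimeP F n K h c₀ cB a U₀ (RS F n K h c₀ cB U₀ (toL2S F K c₀ v))) y‖
        ≤ C₁ * m * Real.exp (-(δ * (Site.tdist (iterBlockOf (K - n) y) z : ℝ))))
    (hc2w : ∀ (z : Site (F.P K) (K - n)) (v : Site (F.P K) 0 → Matrix (Fin 2) (Fin 2) ℂ) (m : ℝ), 0 ≤ m →
      (∀ y, ‖v y‖ ≤ m * Real.exp (-(δ * (Site.tdist (iterBlockOf (K - n) y) z : ℝ)))) →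
      ∀ b, ‖(toL2 F K c₀).symm (DL2 F n K c₀ U₀ (GprimeP F n K h c₀ cB a U₀ (RS F n K h c₀ cB U₀ (toL2S F K c₀ v)))) b‖
        ≤ C₂ * m * Real.exp (-(δ * (Site.tdist (iterBlockOf (K - n) b.src) z : ℝ))))
    (hc3w : ∀ (z : Site (F.P K) (K - n)) (v : Site (F.P K) 0 → Matrix (Fin 2) (Fin 2) ℂ) (m : ℝ), 0 ≤ m →
      (∀ y, ‖v y‖ ≤ m * Real.exp (-(δ * (Site.tdist (iterBlockOf (K - n) y) z : ℝ)))) →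
      ∀ y, ‖(toL2S F K c₀).symm (RS F n K h c₀ cB U₀ (GprimeP F n K h c₀ cB a U₀ (toL2S F K c₀ v))) y‖
        ≤ C₃ * m * Real.exp (-(δ * (Site.tdist (iterBlockOf (K - n) y) z : ℝ))))
    (hwin : 2 * (1 + Real.exp (4 * δ)) * (α * C₁ * (BV + BD)
      + 3 * α * C₃ * (1 + C₂) * (1 + C₂ + 2 * (1 + Real.exp (4 * δ)) * α * C₁ * (BV + BD))) ≤ 1 / 2) :
    ∀ (X : PBond (F.P K) 0 → Matrix (Fin 2) (Fin 2) ℂ) (z : Site (F.P K) (K - n)), (∀ b, X b ≠ 0 → iterBlockOf (K - n) b.src = z) →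
      ∀ s : ℝ, 0 ≤ s → (∀ b, ‖X b‖ ≤ s) →
        ∀ bd : PBond (F.P K) 0, ‖(toL2 F K c₀).symm ((GT F n K h c₀ cB a (DeltaPiSlotP F n K h c₀ cB a) U₀ - GT F n K h c₀ cB a (DeltaEtaSlot F n K c₀) U₀) (toL2 F K c₀ X)) bd‖
          ≤ s * (α * (2 * (BV + BD) * (1 + Real.exp (4 * δ)) * (2 * C₁ * BV + 6 * C₃ * (1 + C₂) * (C₂ + 2 * α * (1 + Real.exp (4 * δ)) * C₁ * BV))))
            * Real.exp (-(δ * (Site.tdist (P := F.P K) (iterBlockOf (K - n) bd.src) z : ℝ))) := by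
  intro X z hXz s hs hX bd
  have h1 := (blockDecay_rows_GTpi_sub_GTeta_of_letters hδ U₀ hreg ha hp₀ hpπ z hBV hBD hC₁ hC₂ hC₃ (hGw z) (hDw z) (hc1w z) (hc2w z) (hc3w z) hwin X hXz hs hX).1 bd
  rw [LinearMap.sub_apply]
  exact h1.trans (le_of_eq (by ring))

/-- ★★★ **THE CONE'S LETTER `hΔb` FROM FIVE BLOCK-SUPPORTED LETTERS** (D3's binders (Gb) (Db) (c1b) (c2b) (c3b) VERBATIM at rate `δ₁ ≥ δ + ν`, constants `×V`, `V := (2(1+1∕ν))³`,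
D2's window in the `×V` constants): the same `hΔb` text with `κΔ = α·κ′(BV·V, BD·V, C₁·V, C₂·V, C₃·V)`. [cite: Balaban1985BackgroundPropagators, (3.122) p.420, (3.47)–(3.49) pp.398–399] -/
theorem hDelta_pi_of_blockLetters {α δ δ₁ ν : ℝ} (hδ : 0 ≤ δ) (hν : 0 < ν) (hδ₁ : δ + ν ≤ δ₁)
    (U₀ : GaugeField (F.P K) 0 (Matrix.specialUnitaryGroup (Fin 2) ℂ)) (hreg : RegPr F n K α U₀) (ha : 0 ≤ a)
    (hp₀ : PosOnto F n K h c₀ cB a (DeltaEtaSlot F n K c₀) U₀) (hpπ : PosOnto F n K h c₀ cB a (DeltaPiSlotP F n K h c₀ cB a) U₀)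
    {BV BD C₁ C₂ C₃ : ℝ} (hBV : 0 ≤ BV) (hBD : 0 ≤ BD) (hC₁ : 0 ≤ C₁) (hC₂ : 0 ≤ C₂) (hC₃ : 0 ≤ C₃)
    (hGb : ∀ (X : PBond (F.P K) 0 → Matrix (Fin 2) (Fin 2) ℂ) (z : Site (F.P K) (K - n)), (∀ b, X b ≠ 0 → iterBlockOf (K - n) b.src = z) →
      ∀ s : ℝ, 0 ≤ s → (∀ b, ‖X b‖ ≤ s) →
        ∀ bd : PBond (F.P K) 0, ‖(toL2 F K c₀).symm (GT F n K h c₀ cB a (DeltaEtaSlot F n K c₀) U₀ (toL2 F K c₀ X)) bd‖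
          ≤ s * BV * Real.exp (-(δ₁ * (Site.tdist (P := F.P K) (iterBlockOf (K - n) bd.src) z : ℝ))))
    (hDb : ∀ (X : PBond (F.P K) 0 → Matrix (Fin 2) (Fin 2) ℂ) (z : Site (F.P K) (K - n)), (∀ b, X b ≠ 0 → iterBlockOf (K - n) b.src = z) →
      ∀ s : ℝ, 0 ≤ s → (∀ b, ‖X b‖ ≤ s) →
        ∀ x : Site (F.P K) 0, ‖(toL2S F K c₀).symm (DstarL2 F n K c₀ U₀ (GT F n K h c₀ cB a (DeltaEtaSlot F n K c₀) U₀ (toL2 F K c₀ X))) x‖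
          ≤ s * BD * Real.exp (-(δ₁ * (Site.tdist (P := F.P K) (iterBlockOf (K - n) x) z : ℝ))))
    (hc1b : ∀ (v : Site (F.P K) 0 → Matrix (Fin 2) (Fin 2) ℂ) (z : Site (F.P K) (K - n)), (∀ y, v y ≠ 0 → iterBlockOf (K - n) y = z) →
      ∀ m : ℝ, 0 ≤ m → (∀ y, ‖v y‖ ≤ m) →
        ∀ y : Site (F.P K) 0, ‖(toL2S F K c₀).symm (GprimeP F n K h c₀ cB a U₀ (RS F n K h c₀ cB U₀ (toL2S F K c₀ v))) y‖
          ≤ m * C₁ * Real.exp (-(δ₁ * (Site.tdist (P := F.P K) (iterBlockOf (K - n) y) z : ℝ))))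
    (hc2b : ∀ (v : Site (F.P K) 0 → Matrix (Fin 2) (Fin 2) ℂ) (z : Site (F.P K) (K - n)), (∀ y, v y ≠ 0 → iterBlockOf (K - n) y = z) →
      ∀ m : ℝ, 0 ≤ m → (∀ y, ‖v y‖ ≤ m) →
        ∀ b : PBond (F.P K) 0, ‖(toL2 F K c₀).symm (DL2 F n K c₀ U₀ (GprimeP F n K h c₀ cB a U₀ (RS F n K h c₀ cB U₀ (toL2S F K c₀ v)))) b‖
          ≤ m * C₂ * Real.exp (-(δ₁ * (Site.tdist (P := F.P K) (iterBlockOf (K - n) b.src) z : ℝ))))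
    (hc3b : ∀ (v : Site (F.P K) 0 → Matrix (Fin 2) (Fin 2) ℂ) (z : Site (F.P K) (K - n)), (∀ y, v y ≠ 0 → iterBlockOf (K - n) y = z) →
      ∀ m : ℝ, 0 ≤ m → (∀ y, ‖v y‖ ≤ m) →
        ∀ y : Site (F.P K) 0, ‖(toL2S F K c₀).symm (RS F n K h c₀ cB U₀ (GprimeP F n K h c₀ cB a U₀ (toL2S F K c₀ v))) y‖
          ≤ m * C₃ * Real.exp (-(δ₁ * (Site.tdist (P := F.P K) (iterBlockOf (K - n) y) z : ℝ))))
    (hwin : 2 * (1 + Real.exp (4 * δ)) * (α * (C₁ * (2 * (1 + 1 / ν)) ^ 3) * (BV * (2 * (1 + 1 / ν)) ^ 3 + BD * (2 * (1 + 1 / ν)) ^ 3)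
      + 3 * α * (C₃ * (2 * (1 + 1 / ν)) ^ 3) * (1 + C₂ * (2 * (1 + 1 / ν)) ^ 3)
        * (1 + C₂ * (2 * (1 + 1 / ν)) ^ 3 + 2 * (1 + Real.exp (4 * δ)) * α * (C₁ * (2 * (1 + 1 / ν)) ^ 3) * (BV * (2 * (1 + 1 / ν)) ^ 3 + BD * (2 * (1 + 1 / ν)) ^ 3))) ≤ 1 / 2) :
    ∀ (X : PBond (F.P K) 0 → Matrix (Fin 2) (Fin 2) ℂ) (z : Site (F.P K) (K - n)), (∀ b, X b ≠ 0 → iterBlockOf (K - n) b.src = z) →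
      ∀ s : ℝ, 0 ≤ s → (∀ b, ‖X b‖ ≤ s) →
        ∀ bd : PBond (F.P K) 0, ‖(toL2 F K c₀).symm ((GT F n K h c₀ cB a (DeltaPiSlotP F n K h c₀ cB a) U₀ - GT F n K h c₀ cB a (DeltaEtaSlot F n K c₀) U₀) (toL2 F K c₀ X)) bd‖
          ≤ s * (α * (2 * ((BV * (2 * (1 + 1 / ν)) ^ 3) + (BD * (2 * (1 + 1 / ν)) ^ 3)) * (1 + Real.exp (4 * δ)) * (2 * (C₁ * (2 * (1 + 1 / ν)) ^ 3) * (BV * (2 * (1 + 1 / ν)) ^ 3) + 6 * (C₃ * (2 * (1 + 1 / ν)) ^ 3) * (1 + (C₂ * (2 * (1 + 1 / ν)) ^ 3)) * ((C₂ * (2 * (1 + 1 / ν)) ^ 3) + 2 * α * (1 + Real.exp (4 * δ)) * (C₁ * (2 * (1 + 1 / ν)) ^ 3) * (BV * (2 * (1 + 1 / ν)) ^ 3)))))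
            * Real.exp (-(δ * (Site.tdist (P := F.P K) (iterBlockOf (K - n) bd.src) z : ℝ))) := by
  have hV : 0 ≤ (2 * (1 + 1 / ν)) ^ 3 := by positivity
  -- block-additivity of the five readers
  have hΦG : ∀ f : Site (F.P K) (K - n) → PBond (F.P K) 0 → Matrix (Fin 2) (Fin 2) ℂ,
      (fun X bd => (toL2 F K c₀).symm (GT F n K h c₀ cB a (DeltaEtaSlot F n K c₀) U₀ (toL2 F K c₀ X)) bd) (∑ z, f z)
        = ∑ z, (fun X bd => (toL2 F K c₀).symm (GT F n K h c₀ cB a (DeltaEtaSlot F n K c₀) U₀ (toL2 F K c₀ X)) bd) (f z) := fun f => by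
    funext bd; simp only [map_sum, Finset.sum_apply]
  have hΦD : ∀ f : Site (F.P K) (K - n) → PBond (F.P K) 0 → Matrix (Fin 2) (Fin 2) ℂ,
      (fun X x => (toL2S F K c₀).symm (DstarL2 F n K c₀ U₀ (GT F n K h c₀ cB a (DeltaEtaSlot F n K c₀) U₀ (toL2 F K c₀ X))) x) (∑ z, f z)
        = ∑ z, (fun X x => (toL2S F K c₀).symm (DstarL2 F n K c₀ U₀ (GT F n K h c₀ cB a (DeltaEtaSlot F n K c₀) U₀ (toL2 F K c₀ X))) x) (f z) := fun f => by
    funext x; simp only [map_sum, Finset.sum_apply]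
  have hΦ1 : ∀ f : Site (F.P K) (K - n) → Site (F.P K) 0 → Matrix (Fin 2) (Fin 2) ℂ,
      (fun v y => (toL2S F K c₀).symm (GprimeP F n K h c₀ cB a U₀ (RS F n K h c₀ cB U₀ (toL2S F K c₀ v))) y) (∑ z, f z)
        = ∑ z, (fun v y => (toL2S F K c₀).symm (GprimeP F n K h c₀ cB a U₀ (RS F n K h c₀ cB U₀ (toL2S F K c₀ v))) y) (f z) := fun f => by
    funext y; simp only [map_sum, Finset.sum_apply]
  have hΦ2 : ∀ f : Site (F.P K) (K - n) → Site (F.P K) 0 → Matrix (Fin 2) (Fin 2) ℂ,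
      (fun v b => (toL2 F K c₀).symm (DL2 F n K c₀ U₀ (GprimeP F n K h c₀ cB a U₀ (RS F n K h c₀ cB U₀ (toL2S F K c₀ v)))) b) (∑ z, f z)
        = ∑ z, (fun v b => (toL2 F K c₀).symm (DL2 F n K c₀ U₀ (GprimeP F n K h c₀ cB a U₀ (RS F n K h c₀ cB U₀ (toL2S F K c₀ v)))) b) (f z) := fun f => by
    funext b; simp only [map_sum, Finset.sum_apply]
  have hΦ3 : ∀ f : Site (F.P K) (K - n) → Site (F.P K) 0 → Matrix (Fin 2) (Fin 2) ℂ,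
      (fun v y => (toL2S F K c₀).symm (RS F n K h c₀ cB U₀ (GprimeP F n K h c₀ cB a U₀ (toL2S F K c₀ v))) y) (∑ z, f z)
        = ∑ z, (fun v y => (toL2S F K c₀).symm (RS F n K h c₀ cB U₀ (GprimeP F n K h c₀ cB a U₀ (toL2S F K c₀ v))) y) (f z) := fun f => by
    funext y; simp only [map_sum, Finset.sum_apply]
  -- the five weighted letters at rate `δ`
  have hGw := fun (z : Site (F.P K) (K - n)) (Y : PBond (F.P K) 0 → Matrix (Fin 2) (Fin 2) ℂ) (m : ℝ) (hm : 0 ≤ m)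
      (hY : ∀ b, ‖Y b‖ ≤ m * Real.exp (-(δ * (Site.tdist (iterBlockOf (K - n) b.src) z : ℝ)))) (bd : PBond (F.P K) 0) =>
    weighted_of_blockSupported (fun b : PBond (F.P K) 0 => iterBlockOf (K - n) b.src) (fun bd : PBond (F.P K) 0 => iterBlockOf (K - n) bd.src) _ hΦG hBV hδ hν hδ₁ hGb z Y m hm hY bd
  have hDw := fun (z : Site (F.P K) (K - n)) (Y : PBond (F.P K) 0 → Matrix (Fin 2) (Fin 2) ℂ) (m : ℝ) (hm : 0 ≤ m)
      (hY : ∀ b, ‖Y b‖ ≤ m * Real.exp (-(δ * (Site.tdist (iterBlockOf (K - n) b.src) z : ℝ)))) (x : Site (F.P K) 0) =>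
    weighted_of_blockSupported (fun b : PBond (F.P K) 0 => iterBlockOf (K - n) b.src) (fun x : Site (F.P K) 0 => iterBlockOf (K - n) x) _ hΦD hBD hδ hν hδ₁ hDb z Y m hm hY x
  have hc1w := fun (z : Site (F.P K) (K - n)) (v : Site (F.P K) 0 → Matrix (Fin 2) (Fin 2) ℂ) (m : ℝ) (hm : 0 ≤ m)
      (hv : ∀ y, ‖v y‖ ≤ m * Real.exp (-(δ * (Site.tdist (iterBlockOf (K - n) y) z : ℝ)))) (y : Site (F.P K) 0) =>
    weighted_of_blockSupported (fun y : Site (F.P K) 0 => iterBlockOf (K - n) y) (fun y : Site (F.P K) 0 => iterBlockOf (K - n) y) _ hΦ1 hC₁ hδ hν hδ₁ hc1b z v m hm hv y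
  have hc2w := fun (z : Site (F.P K) (K - n)) (v : Site (F.P K) 0 → Matrix (Fin 2) (Fin 2) ℂ) (m : ℝ) (hm : 0 ≤ m)
      (hv : ∀ y, ‖v y‖ ≤ m * Real.exp (-(δ * (Site.tdist (iterBlockOf (K - n) y) z : ℝ)))) (b : PBond (F.P K) 0) =>
    weighted_of_blockSupported (fun y : Site (F.P K) 0 => iterBlockOf (K - n) y) (fun b : PBond (F.P K) 0 => iterBlockOf (K - n) b.src) _ hΦ2 hC₂ hδ hν hδ₁ hc2b z v m hm hv b
  have hc3w := fun (z : Site (F.P K) (K - n)) (v : Site (F.P K) 0 → Matrix (Fin 2) (Fin 2) ℂ) (m : ℝ) (hm : 0 ≤ m)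
      (hv : ∀ y, ‖v y‖ ≤ m * Real.exp (-(δ * (Site.tdist (iterBlockOf (K - n) y) z : ℝ)))) (y : Site (F.P K) 0) =>
    weighted_of_blockSupported (fun y : Site (F.P K) 0 => iterBlockOf (K - n) y) (fun y : Site (F.P K) 0 => iterBlockOf (K - n) y) _ hΦ3 hC₃ hδ hν hδ₁ hc3b z v m hm hv y
  exact hDelta_pi_of_letters (BV := BV * (2 * (1 + 1 / ν)) ^ 3) (BD := BD * (2 * (1 + 1 / ν)) ^ 3) (C₁ := C₁ * (2 * (1 + 1 / ν)) ^ 3)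
    (C₂ := C₂ * (2 * (1 + 1 / ν)) ^ 3) (C₃ := C₃ * (2 * (1 + 1 / ν)) ^ 3) hδ U₀ hreg ha hp₀ hpπ
    (mul_nonneg hBV hV) (mul_nonneg hBD hV) (mul_nonneg hC₁ hV) (mul_nonneg hC₂ hV) (mul_nonneg hC₃ hV)
    (fun z Y m hm hY bd => (hGw z Y m hm hY bd).trans (le_of_eq (by ring)))
    (fun z Y m hm hY x => (hDw z Y m hm hY x).trans (le_of_eq (by ring)))
    (fun z v m hm hv y => (hc1w z v m hm hv y).trans (le_of_eq (by ring)))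
    (fun z v m hm hv b => (hc2w z v m hm hv b).trans (le_of_eq (by ring)))
    (fun z v m hm hv y => (hc3w z v m hm hv y).trans (le_of_eq (by ring)))
    hwin

end Rows

end Summit.QuantumFields.YangMills.Theorems.Prop7GreenPiMinusEtaBlockDecay

end
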